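import Summits.NavierStokesRegularity.NavierStokesRegularity.Theorems.AdaptedFrequencyFrequencyRigidityFiniteBridges
import Summits.NavierStokesRegularity.NavierStokesRegularity.Theorems.AdaptedFrequencyFrequencyRigidityAxisymmetricCoreUnit
import HarnessLib

/-!
# Crux `FrequencyRigidity` (stmt-NavierStokesRegularity-2955), line `scaled-energy-split`:
# the AXISYMMETRIC case of the finite piece is closed

Helper file (`--supports stmt-NavierStokesRegularity-2955`; theorems only, sorry-free).  Composition of the
landed `finite_axisymmetric_of_core` (viscosity normalisation of a finite-scaled-energy witness + backward
singularity of the pole, FiniteBridges) with the landed unit-viscosity core `stub_axisymmetricFlatCore_unit`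
(Seregin–Šverák 2009 Thm 3.1 on the gauged pressure, AxisymmetricCoreUnit, worker C of lead c6): **no
axisymmetric witness of the crux body has finite Albritton–Barker quantity**.  In the crux's original class the
axisymmetric case was NOT closable (the `L³(Q₁)` hypothesis of Seregin–Šverák fails for non-decaying profiles,
lead c4); in the finite class `C(Q) ≤ 𝐈 < ⊤` supplies it — the class restriction of the line has teeth.

## References

* G. Seregin, V. Šverák, *On Type I singularities of the local axi-symmetric solutions of the Navier–Stokes
  equations*, Comm. PDE 34 (2009), Thm 3.1. [SereginSverak2009]
* D. Albritton, T. Barker, J. Math. Fluid Mech. 21 (2019), §1. [AlbrittonBarker2019]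
-/

noncomputable section

set_option linter.dupNamespace false

namespace Summit.NavierStokesRegularity.NavierStokesRegularity.Theorems.FrequencyRigidity.ScaledEnergySplit

/-- **Registered sub-goal `stub_finiteAxisymmetricLeaf` (line `scaled-energy-split`): the axisymmetric case of
Stub 2 `stub_finiteScaledEnergyLiouville` is CLOSED** — no `(ν, C, Λ₀, v, q, K)` in the crux body with
`𝐈(v, q, Dv) < ⊤` has axisymmetric velocity slices. [cite: SereginSverak2009, Thm 3.1] -/
theorem stub_finiteAxisymmetricLeaf : ∀ (ν C Λ₀ : ℝ) (v : ℝ → EuclideanSpace ℝ (Fin 3) → EuclideanSpace ℝ (Fin 3)) (q : ℝ → EuclideanSpace ℝ (Fin 3) → ℝ) (K : ℝ → EuclideanSpace ℝ (Fin 3) → ℝ), (0 < ν ∧ Literature.Analysis.FluidPDE.IsClassicalNSSolutionOn (Set.Iio 0) ν 0 v q ∧ (∀ t ∈ Set.Iio (0:ℝ), ∀ x, ‖v t x‖ ≤ C / Real.sqrt (-t)) ∧ ContDiffOn ℝ 2 (Function.uncurry K) (Set.Iio (0:ℝ) ×ˢ Set.univ) ∧ (∀ t ∈ Set.Iio (0:ℝ),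 ∀ x, 0 < K t x) ∧ (∀ t ∈ Set.Iio (0:ℝ), ∀ x, Literature.Analysis.FluidPDE.timeDerivWithin (Set.Iio (0:ℝ)) K t x + fderiv ℝ (K t) x (v t x) + ν * Laplacian.laplacian (K t) x = 0) ∧ (∀ t ∈ Set.Iio (0:ℝ), ∫ x, K t x = 1) ∧ (∀ φ : EuclideanSpace ℝ (Fin 3) → ℝ, Continuous φ → (∃ M : ℝ, ∀ x, |φ x| ≤ M) → Filter.Tendsto (fun t => ∫ x, φ x * K t x) (nhdsWithin (0:ℝ) (Set.Iio (0:ℝ))) (nhds (φ (0 : EuclideanSpace ℝ (Fin 3))))) ∧ (∃ c₁ c₂ C₁ C₂ : ℝ, 0 < c₁ ∧ 0 < c₂ ∧ 0 < C₁ ∧ 0 < C₂ ∧ ∀ t ∈ Set.Iio (0:ℝ), ∀ x, c₁ * ((0:ℝ) - t) ^ (-(3:ℝ) / 2) * Real.exp (-(‖x - (0 : EuclideanSpace ℝ (Fin 3))‖ ^ 2) / (c₂ * ((0:ℝ) - t))) ≤ K t x ∧ K t x ≤ C₁ * ((0:ℝ) - t) ^ (-(3:ℝ) / 2) * Real.exp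 (-(‖x - (0 : EuclideanSpace ℝ (Fin 3))‖ ^ 2) / (C₂ * ((0:ℝ) - t)))) ∧ (∀ H Λ : ℝ → ℝ, H = (fun t => ∫ x, ‖Literature.Analysis.FluidPDE.curl (v t) x‖ ^ 2 * K t x) → Λ = (fun t => (0 - t) * deriv H t / H t) → (∀ t ∈ Set.Iio (0:ℝ), 0 < H t) ∧ (∀ t ∈ Set.Iio (0:ℝ), Λ t = Λ₀))) → Literature.Analysis.FluidPDE.typeIBound (Set.Iio (0:ℝ) ×ˢ Set.univ) v q (fun t x => fderiv ℝ (v t) x) < ⊤ → (∀ t ∈ Set.Iio (0:ℝ), Literature.Analysis.FluidPDE.IsAxisymmetric (v t)) → False :=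
  finite_axisymmetric_of_core stub_axisymmetricFlatCore_unit

end Summit.NavierStokesRegularity.NavierStokesRegularity.Theorems.FrequencyRigidity.ScaledEnergySplit

end
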